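import Summits.QuantumFields.YangMills.Theorems.AlphaInputsT3ACv3SymAvgSixtyNineOfExpansion
import Summits.QuantumFields.YangMills.Theorems.AlphaInputsT3ACv3EMLIterFirstOrderUniformLgeD
import Summits.QuantumFields.YangMills.Theorems.AlphaInputsT3ACv3SymAvgSixtyNineT3
import HarnessLib

/-!
# `AlphaInputsT3ACv3SymAvgSixtyNineT3DL` — R3 2′χ (O″χ) B1, (α)-seam R-ii, L-FLOOR LF-2 CLOSED on the (69)_sym side: **(69)_sym AT THE CLASS OF RECORD FOR EVERY ODD `L > 1`**
# — the twin of ✓`…SymAvgSixtyNineT3` with the block-size floor `5 ≤ L` REMOVED: LEAD's `d ≤ L` engine ✓`EMLIterUniform.norm_iter_sub_one_sub_iterLin_le_uniform_dL` (constant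
# `C′ = 2|n|²(2d+1)·324ℓ² = 453600·L²` at d = 3, SU(2)) fed into the engine-free cover assembly ✓`SymAvgSixtyNineOfExpansion.dist1_plaqHol_iter_le_blockSum_of_cover_of_expansion`
# — lane `pub-balaban3d` ∕ cell `ym3-torus`, seat `ym-ust-19936-w2` (g4), ★★OWNER RULING g26-№20 (LF-2) ∕ LEAD ★w1-19936 g3 split (C2)

WHY.  ✓`…SymAvgSixtyNineT3.eq69sym_of_mem_reg68LocalSet` carries `hL5 : 5 ≤ F.L` ONLY because the k-uniform Prop. 4 of record (`…_uniform`, `hL : d + 2 ≤ L`) is passed through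
the assembly (this seat's LOCATE-L5′); the crux `HistoryTailL` and the skeleton stub quantify every odd `L > 1`.  LEAD's potential-form bookkeeping (✓`…UniformLgeD`) proves the
same expansion with `hLd : d ≤ L` (every `T3Family`: `F.L` odd and `> 1`, so `3 ≤ F.L`) and the L-dependent constant `C′ = 453600·L²`, and (C1) displays the Prop-4 expansion as
a HYPOTHESIS `hP4` of the cover assembly.  THIS FILE is (C2): the T³ knit of ✓`…SixtyNineT3` re-run on that pair.  Numerals (d = 3, N = 2, `ε = eps1Of(j)`, (68) radius
`a = ½C68·ε·L^{−2j}`, `Lʲδ = (5∕2)C68ε`, `m_j = 80·C68·ε` — unchanged): engine window `C′·m_j ≤ 1` ⇔ `36288000·L²·C68·ε ≤ 1` (implies `hN`, `hδ1`, `hM1`); remainder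
`13·(Lʲδ)² + (4C′ + 52)·m_j² = (11612160000·L² + 1331525∕4)·C68²·ε²`; slack `C68²ε²` for the strict `<`.
WHAT IS HERE (def-free).  §1 `remainder69_dL_eq` (the arithmetic; `3 ≤ F.L` is ✓`CritCurvGradLog.three_le_L`, inlined here from `F.hL`); §2 ★★★ `AlphaInputsT3AC.eq69sym_of_mem_reg68LocalSet_dL` (the `h69` binder of LEAD's
✓`h71_of_recLarge_of_eq69sym` at `C₂(L) := (11612160000·L² + 1331529∕4)·C68²` from `U₀ ∈ reg68LocalSet k h` and `∀ j < k, 36288000·L²·C68·eps1Of(j) ≤ 1` — NO `L`-floor);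
§3 ★★★ `AlphaInputsT3AC.h71_of_recLarge_reg68_dL` (the v4 `h71` text from `large67RecSet ∧ reg68LocalSet` and the three displayed record-window rows — NO `L`-floor).
HONEST FRAMING.  Arithmetic over landed theorems; the window rows are DISPLAYED (folded by the lane into `γ₀(L, C68, b₀, p₀)`), now L-dependent through `C′ ∝ L²` — COSMETIC in the
OWNER's LF taxonomy; nothing here proves NODE O's rows, the stub, the crux `HistoryTailL`, or a mass gap; count-neutral helper (`--supports stmt-QuantumFields-19936`), registry
untouched.  YM₃ on T³ is rung R3 of the programme, NOT the Clay problem.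

References: T. Bałaban, Commun. Math. Phys. 102 (1985) 255–275 [Balaban1985UV3] ((67)–(71) p.273); CMP 98 (1985) 17–51 [Balaban1985Averaging] (Prop. 4 (134)–(135) p.38).
-/

set_option autoImplicit false

noncomputable section

namespace Summit.QuantumFields.YangMills.Theorems

open scoped Matrix Matrix.Norms.L2Operator BigOperators
open Literature.MathematicalPhysics.QuantumFieldTheory.Balaban1983to89
open Literature.MathematicalPhysics.QuantumFieldTheory.Balaban1983to89.B10 (pFun)
open Literature.MathematicalPhysics.QuantumFieldTheory.Balaban1983to89.B10Eq38TorusDomains (plaqsIn)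
open Literature.MathematicalPhysics.QuantumFieldTheory.Balaban1983to89.B10Eq70Squaring (blockSum dev)
open Literature.MathematicalPhysics.QuantumFieldTheory.Balaban1983to89.T3ContinuumYM3Torus
open Literature.MathematicalPhysics.QuantumFieldTheory.Balaban1983to89.T3UnitLawDensityEML (ℰp)
open Literature.MathematicalPhysics.QuantumFieldTheory.Balaban1985CMP102
open Literature.MathematicalPhysics.QuantumFieldTheory.Balaban1985CMP102.Setting
open T4Continuum BlockAveraging ExpMeanLog BlockAveragingEMLLinearised
open Summit.QuantumFields.Balaban3D.Carriers
open Summit.QuantumFields.Balaban3D.Proofs.Primitives (AlphaConsts)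
open Summit.QuantumFields.Balaban3D.Proofs.ScalesArithmetic (gk_pos gk_le_one)
open Summit.QuantumFields.Balaban3D.Proofs.CouplingWindow (pFun_pos)
open Summit.QuantumFields.Balaban3D.Proofs.TorusLift (zOf)
open Summit.QuantumFields.Balaban3D.Proofs.LiftBridge (liftCfg)
open Summit.QuantumFields.Balaban3D.Proofs.Run3SmallFactors (regionT)
open Summit.QuantumFields.YangMills.Theorems.SymAvgCover (norm_plaqHol_le_of_mem_reg68LocalSet)
open Summit.QuantumFields.YangMills.Theorems.SymAvgSixtyNineOfExpansion (dist1_plaqHol_iter_le_blockSum_of_cover_of_expansion)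
open Summit.QuantumFields.YangMills.Theorems.LinearLiftMatrix (linAvgIterM linAvgIterM_zero linAvgIterM_succ)
open Summit.QuantumFields.YangMills.Theorems.EMLIterUniform (norm_iter_sub_one_sub_iterLin_le_uniform_dL)

/-! ## §1 Arithmetic -/

/-- The arithmetic of the (69)_sym remainder at d = 3, N = 2, engine constant `C′ = 453600·L²` and the (68) radius `a = ½C68·ε·X⁻²` (`X = L^j`):
`13·(X·(5Xa))² + (4·(C′·(80C68ε)²) + 13·(2·80C68ε)²) = (11612160000·L² + 1331525∕4)·C68²·ε²`. [folklore] -/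
theorem remainder69_dL_eq (Lr C ε X : ℝ) (hX : X ≠ 0) :
    13 * (X * (((3 : ℝ) + 2) * X * (C / 2 * ε * (X⁻¹) ^ 2))) ^ 2 +
        (4 * (453600 * Lr ^ 2 * (80 * C * ε) ^ 2) + 13 * (2 * (80 * C * ε)) ^ 2) =
      (11612160000 * Lr ^ 2 + 1331525 / 4) * C ^ 2 * ε ^ 2 := by
  field_simp
  ring

/-! ## §2 (69)_sym at the class of record, every odd `L > 1` -/

section T3

variable {F : T3Family} {𝔠 : AlphaConsts F.L (suGroupModel 2).N} {γ : ℝ} {hγ : 0 < γ} {hγ1 : γ ≤ (min 𝔠.gamma0 1) ^ 2} {K : ℕ}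

/-- **★★★ (69)_sym AT THE CLASS OF RECORD, IN THE `h69` SHAPE, FOR EVERY ODD `L > 1`.**  For `k ≤ K`, a history `h`, `U₀ ∈ reg68LocalSet k h`, and the window
`36288000·L²·C68·eps1Of(j) ≤ 1` at every `j < k`: every recorded `p′ ∈ P_j(h)` has `|Ū₀^{(j)}(∂p′) − 1| < blockSum (L^j) (L^j•z(p′)) μ ν (dev (lift U₀) μ ν) + b` with
`0 ≤ b ≤ (11612160000·L² + 1331529∕4)·C68²·eps1Of(j)²` (`j`-free, no `κ`, NO block-size floor).  Proof: the (68) reading feeds (C1)'s engine-free cover assembly with the Prop-4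
expansion `hP4` supplied by LEAD's `d ≤ L` engine `…_uniform_dL` at `δ = (d+2)·Lʲ·a`; §1 arithmetic. [cite: Balaban1985UV3, (68)–(69) p.273; Balaban1985Averaging, Prop. 4 (134)–(135) p.38] -/
theorem AlphaInputsT3AC.eq69sym_of_mem_reg68LocalSet_dL {k : ℕ} (hk : k ≤ K) {h : Hist (F.P K) k}
    {U₀ : GaugeField (F.P K) 0 (Matrix.specialUnitaryGroup (Fin 2) ℂ)} (hReg : U₀ ∈ AlphaInputsT3AC.reg68LocalSet F 𝔠 γ hγ hγ1 K k h)
    (hwin : ∀ j, j < k → 36288000 * (F.L : ℝ) ^ 2 * 𝔠.C68 * eps1Of (T3Scales F γ hγ (hγ1.trans (sq_min_one_le _ 𝔠.gamma0_pos)) K) 𝔠.lane.carrier j ≤ 1) :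
    ∀ (j : Fin k) (p : Plaq (F.P K) j), p ∈ h j → ∃ b : ℝ, 0 ≤ b ∧
      b ≤ (11612160000 * (F.L : ℝ) ^ 2 + 1331529 / 4) * 𝔠.C68 ^ 2 * (eps1Of (T3Scales F γ hγ (hγ1.trans (sq_min_one_le _ 𝔠.gamma0_pos)) K) 𝔠.lane.carrier j) ^ 2 ∧
      GaugeGroup.dist1 (GaugeField.plaqHol (Averaging.iter (fun l => BlockAveraging.blockAvg (P := F.P K) (j := l) ℰp) j U₀) p) <
        blockSum (F.L ^ (j : ℕ)) ((F.L ^ (j : ℕ) : ℕ) • zOf p) p.μ p.ν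
          (dev (liftCfg (S := T3Scales F γ hγ (hγ1.trans (sq_min_one_le _ 𝔠.gamma0_pos)) K) (suGroupModel 2) U₀) p.μ p.ν) + b := by
  intro j p hp
  set S : Scales F.L := T3Scales F γ hγ (hγ1.trans (sq_min_one_le _ 𝔠.gamma0_pos)) K with hS
  set ε : ℝ := eps1Of S 𝔠.lane.carrier j with hε
  set X : ℝ := (F.L : ℝ) ^ (j : ℕ) with hX
  have hjK : (j : ℕ) ≤ K := by have := j.2; omega
  have hj1 : (j : ℕ) + 1 ≤ S.P.m + S.P.K := by show (j : ℕ) + 1 ≤ F.m + K; have := j.2; omega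
  have hLd : S.P.d ≤ S.P.L := by
    show 3 ≤ F.L
    obtain ⟨⟨r, hr⟩, h1⟩ := F.hL
    omega
  have hL1 : (1 : ℝ) ≤ F.L := by exact_mod_cast F.hL.2.le
  have hL0 : (0 : ℝ) < F.L := by linarith
  have hX0 : 0 < X := pow_pos hL0 _
  have hX1 : 1 ≤ X := one_le_pow₀ hL1
  have hC : 0 < 𝔠.C68 := 𝔠.C68_pos
  have hgj : 0 < S.gk j := gk_pos S j
  have hε0 : 0 < ε := mul_pos hgj (pFun_pos _ _ _ 𝔠.b₀_pos hgj (gk_le_one S S.gK_le_one j hjK))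
  have hw := hwin j j.2
  have hCε : (F.L : ℝ) ^ 2 * (𝔠.C68 * ε) ≤ 1 / 36288000 := by nlinarith
  have hCε1 : 𝔠.C68 * ε ≤ 1 / 36288000 := by
    have hL2 : (1 : ℝ) ≤ (F.L : ℝ) ^ 2 := one_le_pow₀ hL1
    nlinarith [mul_pos hC hε0]
  -- the (68) radius and its reading on the cover
  set a : ℝ := 𝔠.C68 / 2 * ε * (X⁻¹) ^ 2 with ha
  have ha0 : 0 ≤ a := by positivity
  have hU : ∀ q ∈ plaqsIn 0 (plaqCover p),
      ‖((GaugeField.plaqHol U₀ q : Matrix.specialUnitaryGroup (Fin 2) ℂ) : Matrix (Fin 2) (Fin 2) ℂ) - 1‖ ≤ a := by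
    intro q hq
    have h := norm_plaqHol_le_of_mem_reg68LocalSet hk hReg j hp q hq
    rw [ha, hε, hX]
    exact h
  -- letters of the generic assembly and of the engine at `S`
  have hd3 : (S.P.d : ℝ) = 3 := by rw [show S.P.d = 3 from rfl]; norm_num
  have hLL : (S.P.L : ℝ) = F.L := by rw [show S.P.L = F.L from rfl]
  have hcard : (Fintype.card (Fin 2) : ℝ) = 2 := by rw [Fintype.card_fin]; norm_num
  have hnat : (((S.P.d + 2) * S.P.L : ℕ) : ℝ) = 5 * F.L := by
    rw [show S.P.d = 3 from rfl, show S.P.L = F.L from rfl]; push_cast; ring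
  have hm80 : 2 * (2 : ℝ) ^ 2 * (((3 : ℝ) + 1) * X * (((3 : ℝ) + 2) * X * a)) = 80 * 𝔠.C68 * ε := by
    rw [ha]; field_simp; ring
  have hC' : 2 * (2 : ℝ) ^ 2 * (2 * (3 : ℝ) + 1) * (324 * (5 * (F.L : ℝ)) ^ 2) = 453600 * (F.L : ℝ) ^ 2 := by ring
  have hδ1 : ((S.P.d : ℝ) + 2) * (S.P.L : ℝ) ^ (j : ℕ) * a ≤ 1 := by
    rw [hd3, hLL]
    have h1 : ((3 : ℝ) + 2) * X * a = 5 / 2 * 𝔠.C68 * ε * X⁻¹ := by rw [ha]; field_simp; ring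
    rw [← hX, h1]
    have h2 : X⁻¹ ≤ 1 := inv_le_one_of_one_le₀ hX1
    have h3 : 0 ≤ 5 / 2 * 𝔠.C68 * ε := by positivity
    calc 5 / 2 * 𝔠.C68 * ε * X⁻¹ ≤ 5 / 2 * 𝔠.C68 * ε * 1 := mul_le_mul_of_nonneg_left h2 h3
      _ ≤ 1 := by nlinarith
  have hM1 : 2 * (80 * 𝔠.C68 * ε) ≤ 1 := by nlinarith
  -- the Prop-4 expansion from LEAD's `d ≤ L` engine at `δ := (d+2)·Lʲ·a`, level `k := j`
  have hP4 : ∀ Ut : GaugeField S.P 0 (Matrix.specialUnitaryGroup (Fin 2) ℂ),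
      (∀ b, ‖((Ut b : Matrix.specialUnitaryGroup (Fin 2) ℂ) : Matrix (Fin 2) (Fin 2) ℂ) - 1‖ ≤ ((S.P.d : ℝ) + 2) * (S.P.L : ℝ) ^ (j : ℕ) * a) →
        ∀ c : PBond S.P j,
          ‖((Averaging.iter (fun i => blockAvg (P := S.P) (j := i) (expMeanLogSU (n := Fin 2))) j Ut c : Matrix.specialUnitaryGroup (Fin 2) ℂ) :
              Matrix (Fin 2) (Fin 2) ℂ) - 1‖ ≤ 2 * (80 * 𝔠.C68 * ε) ∧
          ‖((Averaging.iter (fun i => blockAvg (P := S.P) (j := i) (expMeanLogSU (n := Fin 2))) j Ut c : Matrix.specialUnitaryGroup (Fin 2) ℂ) :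
              Matrix (Fin 2) (Fin 2) ℂ) - 1 -
            linAvgIterM (P := S.P) (n := Fin 2) j (fun b => ((Ut b : Matrix.specialUnitaryGroup (Fin 2) ℂ) : Matrix (Fin 2) (Fin 2) ℂ) - 1) c‖ ≤
            453600 * (F.L : ℝ) ^ 2 * (80 * 𝔠.C68 * ε) ^ 2 := by
    intro Ut hUt c
    have hδ : 0 ≤ ((S.P.d : ℝ) + 2) * (S.P.L : ℝ) ^ (j : ℕ) * a := by positivity
    have hm : 2 * (Fintype.card (Fin 2) : ℝ) ^ 2 * (2 * (S.P.d : ℝ) + 1) * (324 * (((S.P.d + 2) * S.P.L : ℕ) : ℝ) ^ 2) *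
        (2 * (Fintype.card (Fin 2) : ℝ) ^ 2 * (((S.P.d : ℝ) + 1) * (S.P.L : ℝ) ^ (j : ℕ) * (((S.P.d : ℝ) + 2) * (S.P.L : ℝ) ^ (j : ℕ) * a))) ≤ 1 := by
      rw [hd3, hLL, hcard, hnat, ← hX, hm80, hC']
      nlinarith
    have hN : 4 * (((S.P.d + 2) * S.P.L : ℕ) : ℝ) *
        (2 * (Fintype.card (Fin 2) : ℝ) ^ 2 * (((S.P.d : ℝ) + 1) * (S.P.L : ℝ) ^ (j : ℕ) * (((S.P.d : ℝ) + 2) * (S.P.L : ℝ) ^ (j : ℕ) * a))) < deltaSU (Fin 2) := by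
      rw [hnat, hd3, hLL, hcard, ← hX, hm80, AvgActionDefect.deltaSU_fin_two]
      nlinarith [mul_pos hC hε0]
    have h := norm_iter_sub_one_sub_iterLin_le_uniform_dL (P := S.P) (linAvgIterM (P := S.P) (n := Fin 2)) (fun Y => linAvgIterM_zero Y)
      (fun s Y c => linAvgIterM_succ s Y c) hLd Ut hδ hUt j hm hN j le_rfl c
    rw [hd3, hLL, hcard, hnat, ← hX, hm80, hC'] at h
    exact h
  -- the engine-free cover assembly
  have hgen := dist1_plaqHol_iter_le_blockSum_of_cover_of_expansion (S := S) (suGroupModel 2) hj1 p U₀ ha0 hU hδ1 hM1 hP4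
  rw [hd3, hLL, ← hX] at hgen
  have hrem : 13 * (X * (((3 : ℝ) + 2) * X * a)) ^ 2 + (4 * (453600 * (F.L : ℝ) ^ 2 * (80 * 𝔠.C68 * ε) ^ 2) + 13 * (2 * (80 * 𝔠.C68 * ε)) ^ 2) =
      (11612160000 * (F.L : ℝ) ^ 2 + 1331525 / 4) * 𝔠.C68 ^ 2 * ε ^ 2 := by
    rw [ha]
    exact remainder69_dL_eq (F.L : ℝ) 𝔠.C68 ε X hX0.ne'
  rw [hrem] at hgen
  refine ⟨(11612160000 * (F.L : ℝ) ^ 2 + 1331525 / 4) * 𝔠.C68 ^ 2 * ε ^ 2 + 𝔠.C68 ^ 2 * ε ^ 2, by positivity, le_of_eq (by ring), ?_⟩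
  have hslack : 0 < 𝔠.C68 ^ 2 * ε ^ 2 := by positivity
  have hSX : (S.P.L ^ (j : ℕ) : ℕ) = F.L ^ (j : ℕ) := rfl
  rw [hSX] at hgen
  have hgen' : GaugeGroup.dist1 (GaugeField.plaqHol (Averaging.iter (fun l => BlockAveraging.blockAvg (P := F.P K) (j := l) ℰp) j U₀) p) ≤
      blockSum (F.L ^ (j : ℕ)) ((F.L ^ (j : ℕ) : ℕ) • zOf p) p.μ p.ν (dev (liftCfg (S := S) (suGroupModel 2) U₀) p.μ p.ν) +
        (11612160000 * (F.L : ℝ) ^ 2 + 1331525 / 4) * 𝔠.C68 ^ 2 * ε ^ 2 := hgen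
  linarith

/-! ## §3 The v4 `h71` text from the class rows and the displayed record windows, every odd `L > 1` -/

/-- **★★★ THE R-ii SEAM ROW FOR PRINT's MAP, SUPPLIED FROM B1's CLASS ROWS, FOR EVERY ODD `L > 1`** (`k ≤ K`): for `U₀ ∈ large67RecSet k h ∩ reg68LocalSet k h` and every
recorded code `e ∈ P(h)`, the v4 `h71` text holds, GIVEN the three displayed record-window rows at every `j < k`: `36288000·L²·C68·eps1Of(j) ≤ 1`, `eps1Of(j) ≤ 1`,
`½(2C68·C₂(L) + C₂(L)²)·eps1Of(j) ≤ ¼` with `C₂(L) = (11612160000·L² + 1331529∕4)·C68²` — LEAD's ✓`h71_of_recLarge_of_eq69sym` with its `h69` binder DISCHARGED by §2; NO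
block-size floor. [cite: Balaban1985UV3, (67)–(71) p.273] -/
theorem AlphaInputsT3AC.h71_of_recLarge_reg68_dL {k : ℕ} (hk : k ≤ K) (h : Hist (F.P K) k)
    {U₀ : GaugeField (F.P K) 0 (Matrix.specialUnitaryGroup (Fin 2) ℂ)}
    (hLarge : U₀ ∈ AlphaInputsT3AC.large67RecSet F 𝔠 γ hγ hγ1 K k h) (hReg : U₀ ∈ AlphaInputsT3AC.reg68LocalSet F 𝔠 γ hγ hγ1 K k h)
    (hwin69 : ∀ j, j < k → 36288000 * (F.L : ℝ) ^ 2 * 𝔠.C68 * eps1Of (T3Scales F γ hγ (hγ1.trans (sq_min_one_le _ 𝔠.gamma0_pos)) K) 𝔠.lane.carrier j ≤ 1)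
    (hwin71 : ∀ j, j < k → eps1Of (T3Scales F γ hγ (hγ1.trans (sq_min_one_le _ 𝔠.gamma0_pos)) K) 𝔠.lane.carrier j ≤ 1 ∧
      (2 * 𝔠.C68 * ((11612160000 * (F.L : ℝ) ^ 2 + 1331529 / 4) * 𝔠.C68 ^ 2) + ((11612160000 * (F.L : ℝ) ^ 2 + 1331529 / 4) * 𝔠.C68 ^ 2) ^ 2) / 2 *
        eps1Of (T3Scales F γ hγ (hγ1.trans (sq_min_one_le _ 𝔠.gamma0_pos)) K) 𝔠.lane.carrier j ≤ 1 / 4)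
    (e : ℕ × PlaqCode (F.P K)) (he : e ∈ Hist.disc h) :
    B10.pFun 𝔠.lane.carrier.b₀ 𝔠.lane.carrier.p₀ ((T3Scales F γ hγ (hγ1.trans (sq_min_one_le _ 𝔠.gamma0_pos)) K).gk e.1) ^ 2 / 4 ≤
      ((suGroupModel 2).N : ℝ) * (((T3Scales F γ hγ (hγ1.trans (sq_min_one_le _ 𝔠.gamma0_pos)) K).gk k)⁻¹ ^ 2 *
        ∑ q ∈ regionT (S := T3Scales F γ hγ (hγ1.trans (sq_min_one_le _ 𝔠.gamma0_pos)) K) e,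
          ((T3Scales F γ hγ (hγ1.trans (sq_min_one_le _ 𝔠.gamma0_pos)) K).eta k)⁻¹ * (1 - GaugeGroup.reTr (GaugeField.plaqHol U₀ q))) :=
  AlphaInputsT3AC.h71_of_recLarge_of_eq69sym (by obtain ⟨⟨r, hr⟩, h1⟩ := F.hL; omega) hk h hLarge hReg
    (AlphaInputsT3AC.eq69sym_of_mem_reg68LocalSet_dL hk hReg hwin69) hwin71 e he

end T3

end Summit.QuantumFields.YangMills.Theorems

end
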